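import Mathlib.Analysis.Complex.CauchyIntegral
import Mathlib.Analysis.Analytic.OfScalars
import Mathlib.Analysis.Analytic.Uniqueness
import Mathlib.Algebra.Polynomial.Basic
import Mathlib.Tactic
import HarnessLib

/-!
# Integer power series with radius of convergence `> 1` are polynomials
(Calegari–Dimitrov–Tang's "Simple Lemma")

The most elementary arithmetic-analytic rigidity statement, the `m = 1`, denominator-free
prototype of all *arithmetic holonomy bounds*: Calegari–Dimitrov–Tang, *The linear independence
of `1`, `ζ(2)`, and `L(2,χ₋₃)`* (arXiv:2408.15403), §1.2, **Lemma 2 (Simple Lemma)**, p. 5: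

> "An integer power series in `ℤ⟦x⟧` that defines a holomorphic function on the disc `|x| < R`
> of a radius `R > 1` is a polynomial."

(There it reformulates the Apéry-scheme Lemma 1 in the integral case, and is the point of departure
for the Borel–Pólya theorem (their Theorem 3) and the holonomy bounds of §2.) The proof is one
line: at a real point `1 < r < R` the terms `aₙ rⁿ` of a convergent series tend to `0`, so the
integers `aₙ` satisfy `|aₙ| < r⁻ⁿ ≤ 1` eventually, i.e. vanish eventually.

## Contents (all proved; no named facts)

* `IntPowerSeries.eventually_eq_zero_of_summable` — core form: if `Σ aₙ rⁿ` converges for one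
  real `r > 1` (`aₙ ∈ ℤ`), then `aₙ = 0` eventually.
* `IntPowerSeries.eventually_eq_zero_of_summable_ball` — the printed reading "the series
  converges (defines a holomorphic function) on `|x| < R`, `R > 1`".
* `IntPowerSeries.eventually_eq_zero_of_differentiableOn` — the analytic-continuation reading:
  if a holomorphic `f` on the disc `|x| < R`, `R > 1`, has Taylor germ `Σ aₙ xⁿ` at `0` with
  `aₙ ∈ ℤ`, then `aₙ = 0` eventually (Cauchy: the germ converges to `f` on the whole disc —
  Mathlib's `DifferentiableOn.hasFPowerSeriesOnBall` and uniqueness of Taylor series).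
* `IntPowerSeries.exists_polynomial_of_eventually_eq_zero` — "is a polynomial": an eventually
  vanishing coefficient sequence is the coefficient sequence of an integer polynomial.

## References

* [CalegariDimitrovTang2024] F. Calegari, V. Dimitrov, Y. Tang, arXiv:2408.15403, §1.2,
  Lemma 2 ("Simple Lemma"), p. 5.
-/

noncomputable section

open Filter Metric
open scoped Topology

namespace Literature.NumberTheory.Transcendental

namespace IntPowerSeries

/-- **Core of the Simple Lemma.** If `aₙ ∈ ℤ` and `Σ aₙ rⁿ` converges for some real `r > 1`,
then `aₙ = 0` for all large `n`: the terms tend to `0`, so eventually `|aₙ| rⁿ < 1 ≤ rⁿ·1`,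
forcing the integer `aₙ` to vanish. [cite: CalegariDimitrovTang2024, §1.2 Lemma 2 (p. 5)] -/
theorem eventually_eq_zero_of_summable {a : ℕ → ℤ} {r : ℝ} (hr : 1 < r)
    (hs : Summable fun n => (a n : ℝ) * r ^ n) : ∀ᶠ n in atTop, a n = 0 := by
  have hr0 : 0 < r := by linarith
  have ht : Tendsto (fun n => ‖(a n : ℝ) * r ^ n‖) atTop (𝓝 0) :=
    (tendsto_zero_iff_norm_tendsto_zero).mp hs.tendsto_atTop_zero
  filter_upwards [ht.eventually (gt_mem_nhds zero_lt_one)] with n hn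
  rw [norm_mul, norm_pow, Real.norm_of_nonneg hr0.le] at hn
  have hrn : 1 ≤ r ^ n := one_le_pow₀ hr.le
  have ha : ‖(a n : ℝ)‖ < 1 := by
    by_contra hcon
    rw [not_lt] at hcon
    have := mul_le_mul hcon hrn zero_le_one (norm_nonneg _)
    linarith
  have ha' : |a n| < 1 := by
    rw [Real.norm_eq_abs] at ha
    exact_mod_cast ha
  exact Int.abs_lt_one_iff.mp ha'

/-- **CDT's Simple Lemma, convergence reading**: an integer power series `Σ aₙ xⁿ ∈ ℤ⟦x⟧` that
converges (and so defines a holomorphic function) at every point of a disc `|x| < R` of radius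
`R > 1` has only finitely many non-zero coefficients.
[cite: CalegariDimitrovTang2024, §1.2 Lemma 2 (p. 5)] -/
theorem eventually_eq_zero_of_summable_ball {a : ℕ → ℤ} {R : ℝ} (hR : 1 < R)
    (h : ∀ z : ℂ, ‖z‖ < R → Summable fun n => (a n : ℂ) * z ^ n) :
    ∀ᶠ n in atTop, a n = 0 := by
  set r : ℝ := (1 + R) / 2 with hr
  have hr1 : 1 < r := by rw [hr]; linarith
  have hrR : r < R := by rw [hr]; linarith
  have hr0 : 0 < r := by linarith
  have hz : ‖((r : ℝ) : ℂ)‖ < R := by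
    rw [Complex.norm_real, Real.norm_of_nonneg hr0.le]; exact hrR
  have hsC := h (r : ℂ) hz
  -- transfer summability from `ℂ` to `ℝ` along `Complex.ofReal`
  have hsR : Summable fun n => (a n : ℝ) * r ^ n := by
    have : (fun n => ((a n : ℝ) * r ^ n : ℝ)) = fun n => Complex.re ((a n : ℂ) * (r : ℂ) ^ n) := by
      funext n
      simp [← Complex.ofReal_intCast, ← Complex.ofReal_pow, ← Complex.ofReal_mul]
    rw [this]
    exact Complex.reCLM.summable hsC
  exact eventually_eq_zero_of_summable hr1 hsR

/-- **CDT's Simple Lemma, analytic-continuation reading**: let `f` be holomorphic on the disc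
`|x| < R`, `R > 1`, and suppose its Taylor germ at `0` is an *integer* power series, i.e.
`f(z) = Σ aₙ zⁿ` near `0` with `aₙ ∈ ℤ`. Then `aₙ = 0` for all large `n` (so `f` is a polynomial
on the disc). The analytic input is Cauchy's theorem in Mathlib's form
`DifferentiableOn.hasFPowerSeriesOnBall` (the Taylor series of `f` converges to `f` on every
closed disc `|x| ≤ r' < R`) together with uniqueness of the germ's power series.
[cite: CalegariDimitrovTang2024, §1.2 Lemma 2 (p. 5)] -/
theorem eventually_eq_zero_of_differentiableOn {a : ℕ → ℤ} {R : ℝ} (hR : 1 < R) {f : ℂ → ℂ}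
    (hf : DifferentiableOn ℂ f (ball (0 : ℂ) R))
    (hgerm : ∀ᶠ z in 𝓝 (0 : ℂ), HasSum (fun n => (a n : ℂ) * z ^ n) (f z)) :
    ∀ᶠ n in atTop, a n = 0 := by
  -- the formal power series with scalar coefficients `aₙ`
  set q : FormalMultilinearSeries ℂ ℂ ℂ := FormalMultilinearSeries.ofScalars ℂ fun n => (a n : ℂ)
    with hq
  have hq_apply : ∀ (y : ℂ) (n : ℕ), q n (fun _ => y) = (a n : ℂ) * y ^ n := by
    intro y n
    rw [hq, FormalMultilinearSeries.ofScalars_apply_eq, smul_eq_mul]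
  -- Step 1: `f` has `q` as power series at `0` (on a small ball where the germ identity holds)
  obtain ⟨ε, hε0, hε⟩ := Metric.eventually_nhds_iff_ball.mp hgerm
  have hε2 : 0 < ε / 2 := by positivity
  let δ : NNReal := ⟨ε / 2, hε2.le⟩
  have hδcoe : (δ : ℝ) = ε / 2 := rfl
  have hδ : (0 : NNReal) < δ := by
    rw [← NNReal.coe_lt_coe, NNReal.coe_zero, hδcoe]
    exact hε2
  -- a bound on the terms at the real point `ε/2` gives `ε/2 ≤ radius`
  have hsum_half : HasSum (fun n => (a n : ℂ) * ((ε / 2 : ℝ) : ℂ) ^ n) (f ((ε / 2 : ℝ) : ℂ)) := by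
    apply hε
    rw [mem_ball, dist_zero_right, Complex.norm_real, Real.norm_of_nonneg hε2.le]
    linarith
  obtain ⟨C, hC⟩ : ∃ C, ∀ n, ‖(a n : ℂ) * ((ε / 2 : ℝ) : ℂ) ^ n‖ ≤ C := by
    obtain ⟨C, hC⟩ := hsum_half.summable.tendsto_atTop_zero.norm.bddAbove_range
    exact ⟨C, fun n => hC ⟨n, rfl⟩⟩
  have hrad : (δ : ENNReal) ≤ q.radius := by
    refine q.le_radius_of_bound C fun n => ?_
    have h1 : ‖q n‖ = ‖(a n : ℂ)‖ := by
      rw [hq, FormalMultilinearSeries.ofScalars_norm]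
    rw [h1, hδcoe]
    have := hC n
    rw [norm_mul, norm_pow, Complex.norm_real, Real.norm_of_nonneg hε2.le] at this
    exact this
  have hq_at : HasFPowerSeriesAt f q 0 := by
    refine ⟨δ, hrad, ENNReal.coe_pos.mpr hδ, fun {y} hy => ?_⟩
    rw [zero_add]
    have hy' : y ∈ ball (0 : ℂ) ε := by
      rw [Metric.eball_coe, mem_ball, dist_zero_right] at hy
      rw [mem_ball, dist_zero_right]
      rw [hδcoe] at hy
      linarith
    simpa only [hq_apply] using hε y hy'
  -- Step 2: Cauchy — on the closed disc of radius `r' = (1+R)/2` the Taylor series is `q`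
  set r' : ℝ := (1 + R) / 2 with hr'
  have hr'1 : 1 < r' := by rw [hr']; linarith
  have hr'R : r' < R := by rw [hr']; linarith
  have hr'0 : 0 < r' := by linarith
  let ρ : NNReal := ⟨r', hr'0.le⟩
  have hρcoe : (ρ : ℝ) = r' := rfl
  have hρ : (0 : NNReal) < ρ := by
    rw [← NNReal.coe_lt_coe, NNReal.coe_zero, hρcoe]
    exact hr'0
  have hsub : closedBall (0 : ℂ) ρ ⊆ ball (0 : ℂ) R := closedBall_subset_ball hr'R
  have hcauchy : HasFPowerSeriesOnBall f (cauchyPowerSeries f 0 ρ) 0 ρ :=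
    (hf.mono hsub).hasFPowerSeriesOnBall hρ
  have hpq : cauchyPowerSeries f 0 ρ = q :=
    hcauchy.hasFPowerSeriesAt.eq_formalMultilinearSeries hq_at
  rw [hpq] at hcauchy
  -- Step 3: so `Σ aₙ zⁿ` converges on `|z| < r'`, in particular at the real point `(1+r')/2 > 1`
  set r : ℝ := (1 + r') / 2 with hr
  have hr1 : 1 < r := by rw [hr]; linarith
  have hrr' : r < r' := by rw [hr]; linarith
  have hr0 : 0 < r := by linarith
  have hmem : ((r : ℝ) : ℂ) ∈ Metric.eball (0 : ℂ) ρ := by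
    rw [Metric.eball_coe, mem_ball, dist_zero_right, Complex.norm_real,
      Real.norm_of_nonneg hr0.le, hρcoe]
    exact hrr'
  have hsumC : Summable fun n => (a n : ℂ) * ((r : ℝ) : ℂ) ^ n := by
    have h := hcauchy.hasSum hmem
    simp only [hq_apply] at h
    exact h.summable
  have hsR : Summable fun n => (a n : ℝ) * r ^ n := by
    have : (fun n => ((a n : ℝ) * r ^ n : ℝ)) =
        fun n => Complex.re ((a n : ℂ) * ((r : ℝ) : ℂ) ^ n) := by
      funext n
      simp [← Complex.ofReal_intCast, ← Complex.ofReal_pow, ← Complex.ofReal_mul]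
    rw [this]
    exact Complex.reCLM.summable hsumC
  exact eventually_eq_zero_of_summable hr1 hsR

/-- "**Is a polynomial**": an eventually vanishing integer sequence is the coefficient sequence
of an integer polynomial (so the power series of the Simple Lemma is that polynomial's Taylor
expansion). [folklore] -/
theorem exists_polynomial_of_eventually_eq_zero {a : ℕ → ℤ} (h : ∀ᶠ n in atTop, a n = 0) :
    ∃ P : Polynomial ℤ, ∀ n, P.coeff n = a n := by
  obtain ⟨N, hN⟩ := eventually_atTop.mp h
  refine ⟨∑ k ∈ Finset.range N, Polynomial.monomial k (a k), fun n => ?_⟩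
  rw [Polynomial.finsetSum_coeff]
  simp only [Polynomial.coeff_monomial]
  rw [Finset.sum_ite_eq' (Finset.range N) n (fun k => a k)]
  split_ifs with hn
  · rfl
  · rw [Finset.mem_range, not_lt] at hn
    exact (hN n hn).symm

/-- **CDT's Simple Lemma, printed form**: an integer power series `Σ aₙ xⁿ` converging on a disc
`|x| < R` with `R > 1` *is a polynomial* — there is `P ∈ ℤ[x]` with `P.coeff n = aₙ` for all
`n`, and then `Σ aₙ zⁿ = P(z)` for every `z`.
[cite: CalegariDimitrovTang2024, §1.2 Lemma 2 (p. 5)] -/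
theorem exists_polynomial_of_summable_ball {a : ℕ → ℤ} {R : ℝ} (hR : 1 < R)
    (h : ∀ z : ℂ, ‖z‖ < R → Summable fun n => (a n : ℂ) * z ^ n) :
    ∃ P : Polynomial ℤ, (∀ n, P.coeff n = a n) ∧
      ∀ z : ℂ, HasSum (fun n => (a n : ℂ) * z ^ n) (Polynomial.aeval z P) := by
  obtain ⟨P, hP⟩ := exists_polynomial_of_eventually_eq_zero
    (eventually_eq_zero_of_summable_ball hR h)
  refine ⟨P, hP, fun z => ?_⟩
  have hfin : ∀ n ∉ P.support, (a n : ℂ) * z ^ n = 0 := by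
    intro n hn
    rw [Polynomial.notMem_support_iff, hP] at hn
    simp [hn]
  have hsum : HasSum (fun n => (a n : ℂ) * z ^ n) (∑ n ∈ P.support, (a n : ℂ) * z ^ n) :=
    hasSum_sum_of_ne_finset_zero hfin
  convert hsum using 1
  rw [Polynomial.aeval_eq_sum_range,
    Finset.sum_subset (Polynomial.supp_subset_range_natDegree_succ)]
  · refine Finset.sum_congr rfl fun n _ => ?_
    rw [hP, zsmul_eq_mul]
  · intro n _ hn
    rw [Polynomial.notMem_support_iff] at hn
    have han : a n = 0 := by rw [← hP n]; exact hn
    simp [han]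

end IntPowerSeries

end Literature.NumberTheory.Transcendental
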